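import Mathlib.LinearAlgebra.Matrix.NonsingularInverse
import Mathlib.LinearAlgebra.Basis.VectorSpace
import Mathlib.LinearAlgebra.Dimension.Constructions
import Mathlib.RingTheory.Noetherian.Basic
import Mathlib.Analysis.Calculus.ContDiff.Bounds
import Mathlib.Analysis.SpecialFunctions.Pow.Real
import Mathlib.Algebra.Order.Floor.Semiring
import Mathlib.Algebra.Group.Nat.Even
import Literature.NumberTheory.DiophantineGeometry.InterpolationDeterminant
import HarnessLib

/-!
# Bombieri–Pila: the Generalized Main Lemma (the determinant method)

The **Generalized Main Lemma** of [BombieriPila1989], §3 (`generalizedMainLemma`), restricted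
to monomial sets `M` all of whose monomials have positive degree (which is the case for the sets
`M_F(δ)` of the application in §3, all of degree `≥ d ≥ 2`): for such a set `M` of `D ≥ 2`
monomials, an interval `I ⊆ [0, N]`, and `f ∈ C^{D-1}` with `‖f‖_{N,D-1} ≤ A` on `I`
(`DerivBoundOn`), the integral points on the graph of `f` over `I` lie on at most
`N W^{2/(D(D-1))} + 1` real algebraic curves defined in `M`, where
`W = D! D^{p-D} A^q N^{p-D(D-1)/2}` (`gmlW`; for positive-degree monomials this is sharper than
the printed `D^p A^q N^{p-D(D-1)/2}`). Note that the Main Lemma of §2 of the paper (monomial set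
`J_d = {j₁ + j₂ ≤ d}`, which contains the constant monomial) is NOT an instance of the theorem
proved here, because of the positive-degree restriction (used in Proposition 1:
`‖1‖_{N,k} = 1/N`).

Ingredients, as in the paper: the interpolation determinant bound (formula (1),
`InterpolationDeterminant.abs_det_le`) with **Proposition 1** (`DerivBoundOn.mul`,
`derivBoundOn_pow_mul_pow`: `‖x^a f^b‖_{N,k} ≤ ((k+1)N)^{a+b-1} ‖f‖^b`) gives **Lemma 4**
(`abs_det_monomials_le`): the `D × D` determinants of monomial values at integral points within
an `x`-interval of length `ρ` are bounded by `ρ^{D(D-1)/2} W`; being integers they vanish when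
this is `< 1`; vanishing of all maximal minors forces a common curve (**Lemma 3**,
`exists_ne_zero_of_minors_eq_zero`); and `[0, N]` is covered by `N/L + 1` windows of length
`L = W^{-2/(D(D-1))}`.

## References

* E. Bombieri, J. Pila, *The number of integral points on arcs and ovals*, Duke Math. J. 59
  (1989) 337–357, §2 (Proposition 1, Lemmas 1–2, Main Lemma) and §3 (Lemmas 3–4, Generalized
  Main Lemma) [BombieriPila1989].
-/

namespace Literature.NumberTheory.DiophantineGeometry.Dioph

open Finset

/-! ### Linear algebra: vanishing maximal minors -/

/-- If all `D × D` minors (with increasingly enumerated rows) of a matrix with rows indexed by a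
finite set `S ⊆ ℤ` vanish, then the columns are linearly dependent: there is a nonzero
coefficient vector annihilated by every row. [folklore] -/
theorem exists_ne_zero_of_minors_eq_zero {D : ℕ} (S : Finset ℤ)
    (B : ℤ → Fin D → ℝ)
    (h : ∀ t ⊆ S, (ht : t.card = D) →
      (Matrix.of fun i j => B (t.orderEmbOfFin ht i) j).det = 0) :
    ∃ c : Fin D → ℝ, c ≠ 0 ∧ ∀ s ∈ S, ∑ j, c j * B s j = 0 := by
  classical
  by_contra hcon
  push Not at hcon
  -- the rows span everything
  set V : Submodule ℝ (Fin D → ℝ) := Submodule.span ℝ (B '' ↑S) with hV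
  have htop : V = ⊤ := by
    by_contra hne
    obtain ⟨φ, hφ0, hle⟩ := Submodule.exists_le_ker_of_lt_top V (lt_top_iff_ne_top.2 hne)
    set c : Fin D → ℝ := fun j => φ (Pi.single j 1) with hc
    have hφc : ∀ w, φ w = ∑ j, c j * w j := fun w => by
      rw [LinearMap.pi_apply_eq_sum_univ φ w]
      refine Finset.sum_congr rfl fun j _ => ?_
      rw [smul_eq_mul, mul_comm]
      congr 2
      funext i
      simp [Pi.single_apply, eq_comm]
    have hc0 : c ≠ 0 := by
      intro hc0
      apply hφ0
      refine LinearMap.ext fun w => ?_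
      rw [hφc, LinearMap.zero_apply]
      simp [hc0]
    obtain ⟨s, hs, hne'⟩ := hcon c hc0
    have hmem : B s ∈ V := Submodule.subset_span ⟨s, hs, rfl⟩
    have := hle hmem
    rw [LinearMap.mem_ker, hφc] at this
    exact hne' this
  -- extract a basis among the rows
  obtain ⟨b, hbsub, hbspan, hbli⟩ := exists_linearIndependent ℝ (B '' (↑S : Set ℤ))
  have hbfin : b.Finite := hbli.set_finite_of_isNoetherian
  haveI : Fintype b := hbfin.fintype
  have hcardb : Fintype.card b = D := by
    have h1 := finrank_span_eq_card hbli
    rw [Subtype.range_coe_subtype, Set.setOf_mem_eq, hbspan] at h1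
    change Module.finrank ℝ V = _ at h1
    rw [htop, finrank_top, Module.finrank_fin_fun] at h1
    exact h1.symm
  -- preimages of the basis vectors
  have hpre : ∀ w ∈ b, ∃ s ∈ S, B s = w := fun w hw => by
    obtain ⟨s, hs, rfl⟩ := hbsub hw
    exact ⟨s, hs, rfl⟩
  choose! pre hpreS hpreB using hpre
  set t : Finset ℤ := hbfin.toFinset.image pre with htdef
  have hpre_inj : Set.InjOn pre b := fun w hw w' hw' heq => by
    rw [← hpreB w hw, ← hpreB w' hw', heq]
  have htcard : t.card = D := by
    rw [htdef, Finset.card_image_of_injOn (by simpa using hpre_inj), Set.Finite.card_toFinset hbfin,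
      hcardb]
  have htS : t ⊆ S := by
    intro s hs
    rw [htdef, Finset.mem_image] at hs
    obtain ⟨w, hw, rfl⟩ := hs
    exact hpreS w (hbfin.mem_toFinset.1 hw)
  -- the selected rows are linearly independent
  set ι := t.orderEmbOfFin htcard with hι
  have hιmem : ∀ i, B (ι i) ∈ b := by
    intro i
    have : ι i ∈ t := Finset.orderEmbOfFin_mem t htcard i
    rw [htdef, Finset.mem_image] at this
    obtain ⟨w, hw, hw'⟩ := this
    rw [← hw', hpreB w (hbfin.mem_toFinset.1 hw)]
    exact hbfin.mem_toFinset.1 hw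
  have hli : LinearIndependent ℝ fun i => B (ι i) := by
    set ψ : Fin D → b := fun i => ⟨B (ι i), hιmem i⟩ with hψ
    have hψinj : Function.Injective ψ := by
      intro i i' hii'
      simp only [hψ, Subtype.mk.injEq] at hii'
      -- B injective on t
      have h1 : ι i ∈ t := Finset.orderEmbOfFin_mem t htcard i
      have h2 : ι i' ∈ t := Finset.orderEmbOfFin_mem t htcard i'
      rw [htdef, Finset.mem_image] at h1 h2
      obtain ⟨w, hw, hw1⟩ := h1
      obtain ⟨w', hw', hw2⟩ := h2
      have hwb := hbfin.mem_toFinset.1 hw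
      have hwb' := hbfin.mem_toFinset.1 hw'
      rw [← hw1, ← hw2, hpreB w hwb, hpreB w' hwb'] at hii'
      subst hii'
      exact ι.injective (by rw [← hw1, ← hw2])
    exact hbli.comp ψ hψinj
  have hunit : IsUnit (Matrix.of fun i j => B (ι i) j) := by
    rw [← Matrix.linearIndependent_rows_iff_isUnit]
    exact hli
  rw [Matrix.isUnit_iff_isUnit_det] at hunit
  exact hunit.ne_zero (h t htS htcard)

/-! ### The norms `‖f‖_{N,k}` of Bombieri–Pila and the product bound (Proposition 1) -/

section Norms

/-- `DerivBoundOn f N k I A` expresses `‖f‖_{N,k} ≤ A` on `I` in the notation of Bombieri–Pila: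
`N^{κ-1} |f^{(κ)}(x)| / κ! ≤ A` for all `κ ≤ k` and `x ∈ I`, written as
`|f^{(κ)}(x)| ≤ κ! · A · (N / N^κ)`. [cite: BombieriPila1989, §2 (definition of `‖f‖_{N,k}`)] -/
def DerivBoundOn (f : ℝ → ℝ) (N : ℝ) (k : ℕ) (I : Set ℝ) (A : ℝ) : Prop :=
  ∀ κ : ℕ, κ ≤ k → ∀ x ∈ I, |iteratedDeriv κ f x| ≤ κ.factorial * A * (N / N ^ κ)

variable {f g : ℝ → ℝ} {N A B : ℝ} {k : ℕ} {I U : Set ℝ}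

/-- `‖f‖_{N,k'} ≤ ‖f‖_{N,k}` for `k' ≤ k`: the bound descends to lower order. [folklore] -/
theorem DerivBoundOn.mono_order (h : DerivBoundOn f N k I A) {k' : ℕ} (hk : k' ≤ k) :
    DerivBoundOn f N k' I A := fun κ hκ x hx => h κ (hκ.trans hk) x hx

/-- On an open set, `|iteratedDeriv|` is the norm of `iteratedFDerivWithin`. [folklore] -/
theorem norm_iteratedFDerivWithin_eq_abs (hU : IsOpen U) {x : ℝ} (hx : x ∈ U) (φ : ℝ → ℝ) (i : ℕ) :
    ‖iteratedFDerivWithin ℝ i φ U x‖ = |iteratedDeriv i φ x| := by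
  rw [norm_iteratedFDerivWithin_eq_norm_iteratedDerivWithin, iteratedDerivWithin_of_isOpen hU hx,
    Real.norm_eq_abs]

/-- **Bombieri–Pila, Proposition 1** (two factors): `‖fg‖_{N,k} ≤ (k+1) N ‖f‖_{N,k} ‖g‖_{N,k}`,
by the Leibniz rule. [cite: BombieriPila1989, Proposition 1] -/
theorem DerivBoundOn.mul (hU : IsOpen U) (hIU : I ⊆ U) (hN : 0 < N)
    (hf : ContDiffOn ℝ k f U) (hg : ContDiffOn ℝ k g U)
    (hfA : DerivBoundOn f N k I A) (hgB : DerivBoundOn g N k I B) (hA : 0 ≤ A) (hB : 0 ≤ B) :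
    DerivBoundOn (fun x => f x * g x) N k I ((k + 1) * N * A * B) := by
  intro κ hκ x hx
  have hxU := hIU hx
  have key := norm_iteratedFDerivWithin_mul_le hf hg hU.uniqueDiffOn hxU (n := κ)
    (by exact_mod_cast hκ)
  simp only [norm_iteratedFDerivWithin_eq_abs hU hxU] at key
  have hNk : ∀ i : ℕ, 0 < N ^ i := fun i => pow_pos hN i
  calc |iteratedDeriv κ (fun y => f y * g y) x|
      ≤ ∑ i ∈ range (κ + 1), (κ.choose i : ℝ) * |iteratedDeriv i f x| *
          |iteratedDeriv (κ - i) g x| := key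
    _ ≤ ∑ i ∈ range (κ + 1), (κ.choose i : ℝ) * (i.factorial * A * (N / N ^ i)) *
          ((κ - i).factorial * B * (N / N ^ (κ - i))) := by
        refine sum_le_sum fun i hi => ?_
        have hi' : i ≤ κ := Nat.lt_succ_iff.1 (mem_range.1 hi)
        have h1 := hfA i (hi'.trans hκ) x hx
        have h2 := hgB (κ - i) ((Nat.sub_le κ i).trans hκ) x hx
        have h3 : 0 ≤ (i.factorial : ℝ) * A * (N / N ^ i) := by positivity
        gcongr
    _ = ∑ i ∈ range (κ + 1), (κ.factorial : ℝ) * A * B * (N * N / N ^ κ) := by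
        refine sum_congr rfl fun i hi => ?_
        have hi' : i ≤ κ := Nat.lt_succ_iff.1 (mem_range.1 hi)
        have hcf : ((κ.choose i : ℕ) : ℝ) * i.factorial * (κ - i).factorial = κ.factorial := by
          exact_mod_cast Nat.choose_mul_factorial_mul_factorial hi'
        have hpow : (N ^ i : ℝ) * N ^ (κ - i) = N ^ κ := by rw [← pow_add, Nat.add_sub_cancel' hi']
        field_simp
        rw [← hcf, ← hpow]
        ring
    _ = (κ + 1) * ((κ.factorial : ℝ) * A * B * (N * N / N ^ κ)) := by
        rw [sum_const, card_range]; simp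
    _ = κ.factorial * ((κ + 1) * N * A * B) * (N / N ^ κ) := by
        field_simp
    _ ≤ κ.factorial * ((k + 1) * N * A * B) * (N / N ^ κ) := by
        have : (κ : ℝ) ≤ k := by exact_mod_cast hκ
        have h0 : 0 ≤ (κ.factorial : ℝ) * (N * A * B) * (N / N ^ κ) := by positivity
        nlinarith

/-- `‖x‖_{N,k} ≤ 1` when `I ⊆ [-N, N]`. [cite: BombieriPila1989, §2] -/
theorem derivBoundOn_id (hI : I ⊆ Set.Icc (-N) N) (hN : 0 < N) : DerivBoundOn (fun x => x) N k I 1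
  := by
  intro κ _ x hx
  rcases κ with _ | κ
  · simpa [abs_le] using hI hx
  rcases κ with _ | κ
  · simp [hN.ne']
  · have : iteratedDeriv (κ + 2) (fun x : ℝ => x) x = 0 := by
      rw [iteratedDeriv_succ']
      have hd : deriv (fun x : ℝ => x) = fun _ => (1 : ℝ) := by funext t; exact deriv_id t
      rw [hd, iteratedDeriv_const]
      simp
    rw [this, abs_zero]
    positivity

/-- **Proposition 1** for the monomials in `x` and `f`:
`‖x^a f^b‖_{N,k} ≤ ((k+1)N)^{a+b-1} ‖f‖^b_{N,k}` for `a + b ≥ 1` (`I ⊆ [-N, N]`).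
[cite: BombieriPila1989, Proposition 1] -/
theorem derivBoundOn_pow_mul_pow (hU : IsOpen U) (hIU : I ⊆ U) (hI : I ⊆ Set.Icc (-N) N)
    (hN : 0 < N) (hf : ContDiffOn ℝ k f U) (hfA : DerivBoundOn f N k I A) (hA : 0 ≤ A) :
    ∀ a b : ℕ, 1 ≤ a + b →
      DerivBoundOn (fun x => x ^ a * f x ^ b) N k I (((k + 1) * N) ^ (a + b - 1) * A ^ b) := by
  -- powers of `f`
  have hpowf : ∀ b : ℕ, 1 ≤ b → DerivBoundOn (fun x => f x ^ b) N k I (((k + 1) * N) ^ (b - 1) * A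
    ^ b) := by
    intro b hb
    induction b with
    | zero => omega
    | succ b ih =>
      rcases Nat.eq_zero_or_pos b with rfl | hb'
      · simpa using hfA
      · have h1 := ih hb'
        have h2 := DerivBoundOn.mul hU hIU hN (hf.pow b) hf h1 hfA (by positivity) hA
        have heq : (k + 1) * N * (((k + 1) * N) ^ (b - 1) * A ^ b) * A =
            ((k + 1) * N) ^ (b + 1 - 1) * A ^ (b + 1) := by
          obtain ⟨b', rfl⟩ : ∃ b', b = b' + 1 := ⟨b - 1, by omega⟩
          simp only [Nat.add_sub_cancel, pow_succ]
          ring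
        rw [heq] at h2
        simpa [pow_succ] using h2
  intro a
  induction a with
  | zero =>
    intro b hb
    simpa using hpowf b (by omega)
  | succ a ih =>
    intro b _
    rcases Nat.eq_zero_or_pos (a + b) with hab | hab
    · have ha : a = 0 := by omega
      have hb : b = 0 := by omega
      subst ha; subst hb
      simpa using derivBoundOn_id hI hN
    · have h1 := ih b hab
      have h2 := DerivBoundOn.mul hU hIU hN contDiffOn_id ((contDiffOn_id.pow a).mul (hf.pow b))
        (derivBoundOn_id hI hN) h1 zero_le_one (by positivity)
      have heq : (k + 1) * N * 1 * (((k + 1) * N) ^ (a + b - 1) * A ^ b) =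
          ((k + 1) * N) ^ (a + 1 + b - 1) * A ^ b := by
        obtain ⟨c, hc⟩ : ∃ c, a + b = c + 1 := ⟨a + b - 1, by omega⟩
        rw [hc, show a + 1 + b - 1 = c + 1 by omega, Nat.add_sub_cancel, pow_succ]
        ring
      rw [heq] at h2
      refine fun κ hκ x hx => ?_
      have := h2 κ hκ x hx
      convert this using 3
      funext y
      simp only [id]
      ring

end Norms

/-! ### Lemma 4: the determinant of monomials at nearby integral points -/

section Lemma4

variable {f : ℝ → ℝ} {N A : ℝ} {I U : Set ℝ}

/-- The Vandermonde-type product is bounded by `ρ^{D(D-1)/2}` when the nodes lie in an interval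
of length `ρ`. [folklore] -/
theorem prod_prod_sub_le_pow {D : ℕ} {x : ℕ → ℝ} (hx : StrictMono x) {ρ : ℝ}
    (hspread : ∀ i < D, x i - x 0 ≤ ρ) :
    ∏ i : Fin D, ∏ l ∈ range i, (x i - x l) ≤ ρ ^ (D * (D - 1) / 2) := by
  have hρ : ∀ (i : Fin D) (l : ℕ), l ∈ range i → x i - x l ≤ ρ := by
    intro i l hl
    have h1 := hspread i i.2
    have h2 : x 0 ≤ x l := hx.monotone (Nat.zero_le l)
    linarith
  calc ∏ i : Fin D, ∏ l ∈ range i, (x i - x l) ≤ ∏ i : Fin D, ∏ _l ∈ range (i : ℕ), ρ := by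
        refine prod_le_prod (fun i _ => prod_nonneg fun l hl => (sub_pos.2 (hx (mem_range.1
          hl))).le)
          fun i _ => prod_le_prod (fun l hl => (sub_pos.2 (hx (mem_range.1 hl))).le)
            fun l hl => hρ i l hl
    _ = ρ ^ (D * (D - 1) / 2) := by
        simp only [prod_const, card_range]
        rw [prod_pow_eq_pow_sum, Fin.sum_univ_eq_sum_range (fun i => i) D, sum_range_id]

/-- **Bombieri–Pila, Lemma 4 (determinant bound).** For monomials `x^{a_j} y^{b_j}` with
`a_j + b_j ≥ 1`, nodes `x 0 < ⋯ < x (D-1)` in an interval `I ⊆ [-N, N]` within distance `ρ`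
of `x 0`, and `f ∈ C^{D-1}` near `I` with `‖f‖_{N,D-1} ≤ A` on `I`,
`|det (x_i^{a_j} f(x_i)^{b_j})| ≤ ρ^{D(D-1)/2} · D! · ∏_{m<D} (N/N^m) · ∏_j (DN)^{a_j+b_j-1}
A^{b_j}`
(formula (1) with Proposition 1). [cite: BombieriPila1989, Lemma 4 and formula (1)] -/
theorem abs_det_monomials_le {D : ℕ} (hD : 1 ≤ D) (e : Fin D → ℕ × ℕ)
    (he : ∀ j, 1 ≤ (e j).1 + (e j).2) (hN : 0 < N) (hA : 0 ≤ A)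
    (hU : IsOpen U) (hIU : I ⊆ U) (hIo : I.OrdConnected) (hIN : I ⊆ Set.Icc (-N) N)
    (hf : ContDiffOn ℝ (D - 1 : ℕ) f U) (hfA : DerivBoundOn f N (D - 1) I A)
    {x : ℕ → ℝ} (hx : StrictMono x) (hxI : ∀ i < D, x i ∈ I) {ρ : ℝ}
    (hspread : ∀ i < D, x i - x 0 ≤ ρ) :
    |(Matrix.of fun i j : Fin D => x i ^ (e j).1 * f (x i) ^ (e j).2).det| ≤
      ρ ^ (D * (D - 1) / 2) * ((D.factorial : ℝ) * (∏ m ∈ range D, N / N ^ m) *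
        ∏ j, (((D : ℝ) * N) ^ ((e j).1 + (e j).2 - 1) * A ^ (e j).2)) := by
  set Φ : Fin D → ℝ := fun j => ((D : ℝ) * N) ^ ((e j).1 + (e j).2 - 1) * A ^ (e j).2 with hΦ
  set K : ℕ → Fin D → ℝ := fun m j => Φ j * (N / N ^ m) with hK
  have hsub : Set.Icc (x 0) (x (D - 1)) ⊆ I :=
    hIo.out (hxI 0 (by omega)) (hxI (D - 1) (by omega))
  -- derivative bounds for the monomial functions
  have hbound : ∀ j, DerivBoundOn (fun t => t ^ (e j).1 * f t ^ (e j).2) N (D - 1) I (Φ j) := by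
    intro j
    have := derivBoundOn_pow_mul_pow hU hIU hIN hN hf hfA hA (e j).1 (e j).2 (he j)
    have hcast : ((D - 1 : ℕ) : ℝ) + 1 = D := by
      rw [Nat.cast_sub hD]; ring
    rwa [hcast] at this
  have h1 := abs_det_le hx hU (hsub.trans hIU) (fun j t => t ^ (e j).1 * f t ^ (e j).2)
    (fun j m hm => ((contDiffOn_id.pow _).mul (hf.pow _)).of_le (by exact_mod_cast (by omega : m ≤
      D - 1)))
    K (fun j m hm t ht => by
      have hm' : m ≤ D - 1 := by omega
      have htI : t ∈ I := hIo.out (hxI 0 (by omega)) (hxI m hm) ht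
      have := hbound j m hm' t htI
      simp only [hK]
      linarith [this])
  refine h1.trans ?_
  have hsum : ∑ σ : Equiv.Perm (Fin D), ∏ i, K (σ i) i =
      (D.factorial : ℝ) * (∏ m ∈ range D, N / N ^ m) * ∏ j, Φ j := by
    have : ∀ σ : Equiv.Perm (Fin D), ∏ i, K (σ i) i = (∏ m ∈ range D, N / N ^ m) * ∏ j, Φ j := by
      intro σ
      simp only [hK, prod_mul_distrib]
      rw [mul_comm]
      congr 1
      rw [Equiv.prod_comp σ (fun i : Fin D => N / N ^ (i : ℕ)),
        Fin.prod_univ_eq_prod_range (fun m => N / N ^ m) D]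
    simp only [this, sum_const, card_univ, Fintype.card_perm, Fintype.card_fin, nsmul_eq_mul]
    ring
  rw [hsum]
  have hnonneg : 0 ≤ (D.factorial : ℝ) * (∏ m ∈ range D, N / N ^ m) * ∏ j, Φ j := by positivity
  exact mul_le_mul_of_nonneg_right (prod_prod_sub_le_pow hx hspread) hnonneg

end Lemma4

/-! ### The Generalized Main Lemma -/

section GML

/-- Strictly monotone extension to `ℕ` of an increasing `D`-tuple. [folklore] -/
theorem exists_strictMono_extension {D : ℕ} (hD : 1 ≤ D) (v : Fin D → ℝ) (hv : StrictMono v) :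
    ∃ x : ℕ → ℝ, StrictMono x ∧ ∀ i : Fin D, x i = v i := by
  refine ⟨fun i => if h : i < D then v ⟨i, h⟩ else v ⟨D - 1, by omega⟩ + ((i + 1 - D : ℕ) : ℝ),
    ?_, fun i => by simp [i.2]⟩
  intro i j hij
  by_cases hj : j < D
  · have hi : i < D := hij.trans hj
    simp only [hi, hj, dif_pos]
    exact hv (show (⟨i, hi⟩ : Fin D) < ⟨j, hj⟩ from hij)
  · simp only [hj, dif_neg, not_false_eq_true]
    by_cases hi : i < D
    · simp only [hi, dif_pos]
      have h1 : v ⟨i, hi⟩ ≤ v ⟨D - 1, by omega⟩ :=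
        hv.monotone (by simp [Fin.le_iff_val_le_val]; omega)
      have h2 : (1 : ℝ) ≤ ((j + 1 - D : ℕ) : ℝ) := by exact_mod_cast (by omega : 1 ≤ j + 1 - D)
      linarith
    · simp only [hi, dif_neg, not_false_eq_true]
      have : ((i + 1 - D : ℕ) : ℝ) < ((j + 1 - D : ℕ) : ℝ) := by exact_mod_cast (by omega : i + 1
        - D < j + 1 - D)
      linarith

/-- The quantity `W = D! · ∏_{m<D} (N/N^m) · ∏_{j∈M} (DN)^{j₁+j₂-1} A^{j₂}` of Lemma 4 for the
monomial set `M` (`D = #M`). For `M` consisting of positive-degree monomials (the hypothesis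
`hM` of `generalizedMainLemma`) one has `W = D! D^{p-D} A^q N^p / N^{D(D-1)/2}` with
`p = ∑ (j₁+j₂)`, `q = ∑ j₂` (the `ℕ`-subtraction `j₁ + j₂ - 1` truncates at the constant
monomial, where the identity fails by a factor `DN`). [folklore] -/
noncomputable def gmlW (M : Finset (ℕ × ℕ)) (N A : ℝ) : ℝ :=
  (M.card.factorial : ℝ) * (∏ m ∈ range M.card, N / N ^ m) *
    ∏ j ∈ M, (((M.card : ℝ) * N) ^ (j.1 + j.2 - 1) * A ^ j.2)

/-- `W > 0`. [folklore] -/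
theorem gmlW_pos (M : Finset (ℕ × ℕ)) {N A : ℝ} (hN : 0 < N) (hA : 0 < A) : 0 < gmlW M N A := by
  unfold gmlW
  refine mul_pos (mul_pos (by positivity) (prod_pos fun m _ => by positivity)) ?_
  refine prod_pos fun j hj => ?_
  have : 0 < (M.card : ℝ) := by exact_mod_cast Finset.card_pos.2 ⟨j, hj⟩
  positivity

/-- `D(D-1)/2` as a real number. [folklore] -/
theorem cast_choose_two (D : ℕ) : ((D * (D - 1) / 2 : ℕ) : ℝ) = (D : ℝ) * (D - 1 : ℕ) / 2 := by
  have h : 2 ∣ D * (D - 1) := even_iff_two_dvd.1 (Nat.even_mul_pred_self D)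
  rw [Nat.cast_div h (by norm_num)]
  push_cast
  ring

/-- **Bombieri–Pila, Generalized Main Lemma** (§3), restricted to positive-degree monomials
(sharper constant `D! D^{p-D}` in place of `D^p`). Let `M` be a set of `D ≥ 2` monomials
`x^{j₁} y^{j₂}` of positive degree, `I ⊆ [0, N]` an interval (`N > 0`), and `f ∈ C^{D-1}` near
`I` with `‖f‖_{N,D-1} ≤ A` on `I` (`A > 0`). Then the integral points on the graph of `f` over
`I` lie on at most `N · W^{2/(D(D-1))} + 1` real algebraic curves defined in `M` (nonzero
polynomials supported on `M`), where `W = D! D^{p-D} A^q N^{p - D(D-1)/2}`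
(`≤ D^p A^q N^{p-D(D-1)/2}`, giving the printed bound
`(D^p ‖f‖^q)^{2/(D(D-1))} N^{2p/(D(D-1))} + 1`).
Scope: the paper states the lemma for an arbitrary finite `M`; this version requires
`j₁ + j₂ ≥ 1` for all monomials (as Proposition 1 does), which holds in the application to
`M_F(δ)` in §3 but NOT for the Main Lemma of §2 (`J_d` contains the constant monomial), which is
therefore not an instance of this theorem.
[cite: BombieriPila1989, Generalized Main Lemma (§3)] -/
theorem generalizedMainLemma (M : Finset (ℕ × ℕ)) (hM : ∀ j ∈ M, 1 ≤ j.1 + j.2)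
    (hD : 2 ≤ M.card) {N A : ℝ} (hN : 0 < N) (hA : 0 < A)
    {I U : Set ℝ} (hU : IsOpen U) (hIU : I ⊆ U) (hIo : I.OrdConnected) (hI0N : I ⊆ Set.Icc 0 N)
    {f : ℝ → ℝ} (hf : ContDiffOn ℝ (M.card - 1 : ℕ) f U)
    (hfA : DerivBoundOn f N (M.card - 1) I A) :
    ∃ (n : ℕ) (c : Fin n → ℕ × ℕ → ℝ),
      (n : ℝ) ≤ N * gmlW M N A ^ (2 / ((M.card : ℝ) * (M.card - 1 : ℕ))) + 1 ∧
      (∀ g, ∃ j ∈ M, c g j ≠ 0) ∧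
      ∀ m n' : ℤ, (m : ℝ) ∈ I → f m = n' →
        ∃ g, ∑ j ∈ M, c g j * (m : ℝ) ^ j.1 * (n' : ℝ) ^ j.2 = 0 := by
  classical
  set D := M.card with hDdef
  set E : ℕ := D * (D - 1) / 2 with hEdef
  have hE : 1 ≤ E := by
    rw [hEdef, Nat.le_div_iff_mul_le (by norm_num)]
    have : 1 ≤ D - 1 := by omega
    nlinarith
  have hN0 : 0 < N := hN
  set W := gmlW M N A with hWdef
  have hW : 0 < W := gmlW_pos M hN0 hA
  have hEreal : ((E : ℕ) : ℝ) = (D : ℝ) * (D - 1 : ℕ) / 2 := cast_choose_two D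
  have hEpos : (0 : ℝ) < E := by exact_mod_cast hE
  -- the length scale `L = W^{-1/E}`
  set L : ℝ := W ^ (-(1 / (E : ℝ))) with hLdef
  have hL : 0 < L := Real.rpow_pos_of_pos hW _
  have hLE : L ^ E * W = 1 := by
    rw [hLdef, ← Real.rpow_natCast, ← Real.rpow_mul hW.le, neg_mul, one_div,
      inv_mul_cancel₀ hEpos.ne', Real.rpow_neg hW.le, Real.rpow_one, inv_mul_cancel₀ hW.ne']
  have hNL : N / L = N * W ^ (2 / ((D : ℝ) * (D - 1 : ℕ))) := by
    rw [hLdef, Real.rpow_neg hW.le, div_inv_eq_mul]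
    congr 2
    rw [hEreal]
    field_simp
  -- enumeration of the monomials
  set e : Fin D → ℕ × ℕ := fun j => (M.equivFin.symm j).1 with hedef
  have heM : ∀ j, e j ∈ M := fun j => (M.equivFin.symm j).2
  have he1 : ∀ j, 1 ≤ (e j).1 + (e j).2 := fun j => hM _ (heM j)
  -- the rows
  set Brow : ℤ → Fin D → ℝ := fun m j => (m : ℝ) ^ (e j).1 * f m ^ (e j).2 with hBrow
  -- group index
  set γ : ℤ → ℕ := fun m => ⌊(m : ℝ) / L⌋₊ with hγ
  set ng : ℕ := ⌊N / L⌋₊ + 1 with hng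
  -- integral points
  set P : Set ℤ := {m : ℤ | (m : ℝ) ∈ I ∧ ∃ n' : ℤ, f m = n'} with hP
  have hPfin : P.Finite := by
    refine (Set.finite_Icc (0 : ℤ) ⌈N⌉).subset ?_
    intro m hm
    obtain ⟨hmI, -⟩ := hm
    have h1 := (hI0N hmI).2
    have h0 := (hI0N hmI).1
    constructor
    · exact Int.cast_nonneg_iff.1 h0
    · exact Int.cast_le.1 (h1.trans (Int.le_ceil N))
  -- the key step: points of one group lie on a curve
  have hgroup : ∀ g : ℕ, ∃ c : Fin D → ℝ, c ≠ 0 ∧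
      ∀ m ∈ P, γ m = g → ∑ j, c j * Brow m j = 0 := by
    intro g
    set S : Finset ℤ := (hPfin.toFinset).filter fun m => γ m = g with hS
    suffices hminors : ∀ t ⊆ S, (htc : t.card = D) →
        (Matrix.of fun i j => Brow (t.orderEmbOfFin htc i) j).det = 0 by
      obtain ⟨c, hc0, hc⟩ := exists_ne_zero_of_minors_eq_zero S Brow hminors
      refine ⟨c, hc0, fun m hm hmg => hc m ?_⟩
      exact Finset.mem_filter.2 ⟨hPfin.mem_toFinset.2 hm, hmg⟩
    -- minors vanish
    intro t ht htc
    have hD1 : 1 ≤ D := by omega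
    have htP : ∀ m ∈ t, m ∈ P ∧ γ m = g := fun m hm => by
      have := Finset.mem_filter.1 (ht hm)
      exact ⟨hPfin.mem_toFinset.1 this.1, this.2⟩
    set v : Fin D → ℝ := fun i => (t.orderEmbOfFin htc i : ℝ) with hv
    have hvmono : StrictMono v := fun i j hij => by
      simp only [hv]
      exact_mod_cast (t.orderEmbOfFin htc).strictMono hij
    obtain ⟨x, hx, hxv⟩ := exists_strictMono_extension hD1 v hvmono
    have hxt : ∀ i : Fin D, ∃ m ∈ t, x i = (m : ℝ) := fun i =>
      ⟨_, Finset.orderEmbOfFin_mem t htc i, by rw [hxv]⟩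
    have hxI : ∀ i < D, x i ∈ I := by
      intro i hi
      obtain ⟨m, hm, hxm⟩ := hxt ⟨i, hi⟩
      rw [show x i = x ((⟨i, hi⟩ : Fin D) : ℕ) from rfl, hxm]
      exact (htP m hm).1.1
    -- spread
    set ρ := x (D - 1) - x 0 with hρ
    have hρL : ρ < L := by
      obtain ⟨m₁, hm₁, h₁⟩ := hxt ⟨D - 1, by omega⟩
      obtain ⟨m₀, hm₀, h₀⟩ := hxt ⟨0, by omega⟩
      have hg₁ := (htP m₁ hm₁).2
      have hg₀ := (htP m₀ hm₀).2
      have hm₁0 : (0 : ℝ) ≤ m₁ := (hI0N (htP m₁ hm₁).1.1).1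
      have hm₀0 : (0 : ℝ) ≤ m₀ := (hI0N (htP m₀ hm₀).1.1).1
      simp only [hγ] at hg₁ hg₀
      rw [Nat.floor_eq_iff (div_nonneg hm₁0 hL.le)] at hg₁
      rw [Nat.floor_eq_iff (div_nonneg hm₀0 hL.le)] at hg₀
      have e1 : x (D - 1) = m₁ := by
        rw [show x (D - 1) = x ((⟨D - 1, by omega⟩ : Fin D) : ℕ) from rfl, h₁]
      have e0 : x 0 = m₀ := by
        rw [show x 0 = x ((⟨0, by omega⟩ : Fin D) : ℕ) from rfl, h₀]
      rw [hρ, e1, e0]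
      have := hg₁.2
      have := hg₀.1
      rw [div_lt_iff₀ hL] at hg₁
      rw [le_div_iff₀ hL] at hg₀
      nlinarith [hg₁.2, hg₀.1]
    have hρ0 : 0 ≤ ρ := by
      rw [hρ]
      linarith [hx.monotone (Nat.zero_le (D - 1))]
    have hspread : ∀ i < D, x i - x 0 ≤ ρ := fun i hi => by
      rw [hρ]
      linarith [hx.monotone (show i ≤ D - 1 by omega)]
    have hdet := abs_det_monomials_le hD1 e he1 hN0 hA.le hU hIU hIo
      (hI0N.trans (Set.Icc_subset_Icc (by linarith) le_rfl)) hf hfA hx hxI hspread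
    -- the determinant is an integer of absolute value `< 1`
    have hlt : |(Matrix.of fun i j : Fin D => x i ^ (e j).1 * f (x i) ^ (e j).2).det| < 1 := by
      refine hdet.trans_lt ?_
      have hWeq : (D.factorial : ℝ) * (∏ m ∈ range D, N / N ^ m) *
          ∏ j, (((D : ℝ) * N) ^ ((e j).1 + (e j).2 - 1) * A ^ (e j).2) = W := by
        rw [hWdef, gmlW, ← Finset.prod_coe_sort M, ← Equiv.prod_comp M.equivFin.symm]
      rw [hWeq]
      calc ρ ^ E * W < L ^ E * W := by gcongr
        _ = 1 := hLE
    -- identify the matrix with `Brow` at the points of `t` and with an integer matrix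
    have hmat : (Matrix.of fun i j : Fin D => x i ^ (e j).1 * f (x i) ^ (e j).2) =
        Matrix.of fun i j => Brow (t.orderEmbOfFin htc i) j := by
      ext i j
      simp only [Matrix.of_apply, hBrow, hxv, hv]
    rw [hmat] at hlt
    -- integrality
    have hint : ∀ m ∈ t, ∃ n' : ℤ, f m = n' := fun m hm => (htP m hm).1.2
    choose! nn hnn using hint
    set Bint : Matrix (Fin D) (Fin D) ℤ :=
      Matrix.of fun i j => (t.orderEmbOfFin htc i) ^ (e j).1 * nn (t.orderEmbOfFin htc i) ^ (e j).2
      with hBint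
    have hcast : (Matrix.of fun i j => Brow (t.orderEmbOfFin htc i) j) =
        (Int.castRingHom ℝ).mapMatrix Bint := by
      ext i j
      simp only [Matrix.of_apply, hBrow, RingHom.mapMatrix_apply, Matrix.map_apply, hBint,
        eq_intCast, Int.cast_mul, Int.cast_pow]
      rw [hnn _ (Finset.orderEmbOfFin_mem t htc i)]
    rw [hcast, ← RingHom.map_det, eq_intCast, ← Int.cast_abs, ← Int.cast_one, Int.cast_lt,
      Int.abs_lt_one_iff] at hlt
    rw [hcast, ← RingHom.map_det, hlt, map_zero]
  choose cg hcg0 hcg using hgroup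
  -- the curves
  refine ⟨ng, fun g jj => if h : jj ∈ M then cg g (M.equivFin ⟨jj, h⟩) else 0, ?_, ?_, ?_⟩
  · -- count
    have h1 : ((⌊N / L⌋₊ : ℕ) : ℝ) ≤ N / L := Nat.floor_le (div_nonneg hN0.le hL.le)
    rw [hng, Nat.cast_add, Nat.cast_one, ← hNL]
    linarith
  · -- nonzero
    intro g
    obtain ⟨j, hj⟩ := Function.ne_iff.1 (hcg0 g)
    refine ⟨e j, heM j, ?_⟩
    simp only [heM j, dif_pos]
    have : M.equivFin ⟨e j, heM j⟩ = j := by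
      simp [hedef]
    rw [this]
    exact hj
  · -- the relations
    intro m n' hmI hmn
    have hmP : m ∈ P := ⟨hmI, n', hmn⟩
    have hγm : γ m < ng := by
      rw [hng, Nat.lt_succ_iff]
      refine Nat.floor_mono ?_
      exact div_le_div_of_nonneg_right (hI0N hmI).2 hL.le
    refine ⟨⟨γ m, hγm⟩, ?_⟩
    have h := hcg (γ m) m hmP rfl
    rw [← h]
    -- rewrite the sum over `M` as a sum over `Fin D`
    rw [← Finset.sum_coe_sort M]
    rw [← Equiv.sum_comp M.equivFin.symm]
    refine Finset.sum_congr rfl fun j _ => ?_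
    simp only [hBrow, Finset.coe_mem, dif_pos, Subtype.coe_eta, Equiv.apply_symm_apply, hmn, hedef]
    ring

end GML

end Literature.NumberTheory.DiophantineGeometry.Dioph
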